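import Literature.MathematicalPhysics.QuantumFieldTheory.Balaban1983to89.B12Sec2to5

/-!
# `BalabanUV.Gaps.SecondMomentTruncation` — cell pub-balaban-gaps, row (D1): THE (1.22) SECOND MOMENT OF A (5.10)-DECAYING KERNEL IS ITS FINITE
# TRUNCATION UP TO AN EXPLICIT EXPONENTIALLY SMALL TAIL — `|secondMoment P μ ν − Σ_{x∈S} P μ ν x·x_μ·x_ν| ≤ e^{−(δ₁∕2)·R}·betaPrime510 d C (δ₁∕2)`
# for every finite `S ⊇ {x : |x|₁ < R}` (the ENGINE-FACING companion of the value sockets `Gaps.D1ValueSockets`: a certified finite sum plus numeric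
# `(C, δ₁)` encloses `β⁰_j = secondMoment (TbalOf Lc Js j) μ ν` — every entry of a typed step kernel is `Decay510`, `OneStepKernelFamily.hdec_TOf`)

HONEST FRAMING (cell contract, verbatim): «discharging `BetaPertH` makes Bałaban's UV stability UNCONDITIONAL — a real constructive-QFT result;
it is NOT the continuum limit and NOT the Clay problem.»  HONEST DEPENDENCY (verbatim): «continuum YM on T⁴ ⇐ BetaPertH ∧ nine spine estimates
(0/9 proved); BetaPertH ⇐ (D1) ∧ (D4) ∧ CAP+tail; G-an2-4 gates asym, D1 and NE2/3/4.»  THIS MODULE DISCHARGES NOTHING: [folklore] `tsum` bookkeeping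
over `B12Sec2to5.Decay510` ∕ `majorant_summable` ∕ `betaPrime510` (the typer lineage's (5.10)·(5.42) dictionary), for an ARBITRARY kernel `P`; nothing of
Bałaban's asserted; no number enters (the teeth are the NUMERIC `C, δ₁` of a supplier — `hdec_TOf` gives them existentially only); (D1) NOT discharged;
0∕4 row-D1 binders; NOT BetaPertH, NOT continuum, NOT Clay.  No `def`, no `def … : Prop`, nothing cited, 0 sorry.

CONTENT.  §1 `majorant_tail_le`: on `{R ≤ |x|₁}` the (5.10)·(5.42) majorant `|x|₁²·e^{−δ₁|x|₁}` is `≤ e^{−(δ₁∕2)R}·(|x|₁²·e^{−(δ₁∕2)|x|₁})` (`0 ≤ δ₁`).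
§2 `abs_secondMoment_sub_sum_le_of_decay510`: for `Decay510 (P μ ν) C δ₁`, `0 < δ₁`, and a finite `S` with `∀ x ∉ S, R ≤ |x|₁`:
`|secondMoment P μ ν − Σ_{x∈S} P μ ν x·x_μ·x_ν| ≤ Real.exp (−(δ₁∕2)·R) · betaPrime510 d C (δ₁∕2)` (the complement's `tsum` against the damped majorant,
`sum_add_tsum_compl` + `Summable.tsum_subtype_le`; `C ≥ 0` is automatic from `Decay510` at `x = 0`, `decay510_const_nonneg`).  §3 the ENGINE's reading `secondMoment_mem_Icc_of_decay510_sum`: `secondMoment P μ ν ∈ [Σ_S − τ, Σ_S + τ]`,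
`τ := e^{−(δ₁∕2)R}·betaPrime510 d C (δ₁∕2)`.

ABSOLUTE RULE (cell charter, verbatim): «No internally-minted statement may enter as a cited fact. Every hypothesis is either kernel-proved in this
package or a verbatim quotation of a PUBLISHED theorem with page reference. The manuscript(s) under audit are NOT citable for their own disputed
steps — they are the thing under adjudication; programme-internal (2001/route/tribunal) claims are never citable.»

Provenance: cell pub-balaban-gaps, seat g1-p1 GEN 7 (prover-pub-balaban-gaps-g1-p1-g7-0), 2026-08-23; imports `B12Sec2to5` ONLY; no existing file touched.
-/

noncomputable section

open Finset Filter Topology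
open scoped BigOperators
open Literature.MathematicalPhysics.QuantumFieldTheory.Balaban1983to89
open B12Sec2to5 (l1 l1_nonneg Decay510 betaPrime510 majorant_summable abs_term_le_of_decay510 secondMoment_abs_le_of_decay510)

namespace Summit.QuantumFields.BalabanUV.Gaps.SecondMomentTruncation

variable {d : ℕ}

/-! ## §1 The majorant beyond radius `R` -/

/-- [folklore] On `{R ≤ |x|₁}` the majorant loses half its rate to an explicit prefactor:
`|x|₁²·e^{−δ|x|₁} ≤ e^{−(δ∕2)·R}·(|x|₁²·e^{−(δ∕2)|x|₁})` (`0 ≤ δ`). -/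
theorem majorant_tail_le {δ R : ℝ} (hδ : 0 ≤ δ) {x : Fin d → ℤ} (hx : R ≤ l1 x) :
    l1 x ^ 2 * Real.exp (-δ * l1 x) ≤ Real.exp (-(δ / 2) * R) * (l1 x ^ 2 * Real.exp (-(δ / 2) * l1 x)) := by
  have hsplit : Real.exp (-δ * l1 x) = Real.exp (-(δ / 2) * l1 x) * Real.exp (-(δ / 2) * l1 x) := by
    rw [← Real.exp_add]; congr 1; ring
  have hmono : Real.exp (-(δ / 2) * l1 x) ≤ Real.exp (-(δ / 2) * R) :=
    Real.exp_le_exp.mpr (by nlinarith)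
  have hsq : 0 ≤ l1 x ^ 2 := sq_nonneg _
  calc l1 x ^ 2 * Real.exp (-δ * l1 x)
      = (l1 x ^ 2 * Real.exp (-(δ / 2) * l1 x)) * Real.exp (-(δ / 2) * l1 x) := by rw [hsplit]; ring
    _ ≤ (l1 x ^ 2 * Real.exp (-(δ / 2) * l1 x)) * Real.exp (-(δ / 2) * R) :=
        mul_le_mul_of_nonneg_left hmono (mul_nonneg hsq (Real.exp_pos _).le)
    _ = Real.exp (-(δ / 2) * R) * (l1 x ^ 2 * Real.exp (-(δ / 2) * l1 x)) := by ring

/-- [folklore] The (5.10) constant is `≥ 0` (evaluate at `x = 0`, where `|x|₁ = 0`). -/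
theorem decay510_const_nonneg {P : (Fin d → ℤ) → ℝ} {C δ₁ : ℝ} (h : Decay510 P C δ₁) : 0 ≤ C := by
  have h0 := h 0
  have hl : l1 (0 : Fin d → ℤ) = 0 := by simp [l1]
  rw [hl, mul_zero, Real.exp_zero, mul_one] at h0
  exact (abs_nonneg _).trans h0

/-! ## §2 The truncation rate -/

/-- [folklore] **THE (1.22) MOMENT VS ITS FINITE TRUNCATION, EXPLICIT TAIL.**  If the `(μ, ν)` entry of a kernel obeys (5.10) with constant `C` and rate
`δ₁ > 0`, then for every finite set `S` of lattice points containing all `x` with `|x|₁ < R`,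
`|secondMoment P μ ν − Σ_{x∈S} P μ ν x·x_μ·x_ν| ≤ e^{−(δ₁∕2)·R} · betaPrime510 d C (δ₁∕2)`. -/
theorem abs_secondMoment_sub_sum_le_of_decay510 {P : B12Beta.Kernel d} {C δ₁ : ℝ} {μ ν : Fin d} (hδ : 0 < δ₁)
    (h : Decay510 (P μ ν) C δ₁) (S : Finset (Fin d → ℤ)) {R : ℝ} (hS : ∀ x, x ∉ S → R ≤ l1 x) :
    |B12Beta.secondMoment P μ ν - ∑ x ∈ S, P μ ν x * (x μ : ℝ) * (x ν : ℝ)|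
      ≤ Real.exp (-(δ₁ / 2) * R) * betaPrime510 d C (δ₁ / 2) := by
  set f : (Fin d → ℤ) → ℝ := fun x => P μ ν x * (x μ : ℝ) * (x ν : ℝ) with hf
  set g : (Fin d → ℤ) → ℝ := fun x => C * (l1 x ^ 2 * Real.exp (-(δ₁ / 2) * l1 x)) with hg
  have hC : 0 ≤ C := decay510_const_nonneg h
  have hsumm : Summable f := (secondMoment_abs_le_of_decay510 hδ h).1
  have hgsumm : Summable g := (majorant_summable (half_pos hδ) d).mul_left C
  have hg0 : ∀ x, 0 ≤ g x := fun x => by positivity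
  -- the tail as a `tsum` over the complement of `S`
  have htail : B12Beta.secondMoment P μ ν - ∑ x ∈ S, f x = ∑' x : ↥((S : Set (Fin d → ℤ))ᶜ), f x := by
    have h1 := hsumm.sum_add_tsum_compl (s := S)
    have e : B12Beta.secondMoment P μ ν = ∑' x, f x := rfl
    rw [e, ← h1, add_sub_cancel_left]
  -- pointwise domination on the complement
  have hpt : ∀ x : ↥((S : Set (Fin d → ℤ))ᶜ), ‖f x‖ ≤ Real.exp (-(δ₁ / 2) * R) * g x := by
    intro x
    have hx : x.1 ∉ S := fun hmem => x.2 (Finset.mem_coe.mpr hmem)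
    rw [Real.norm_eq_abs, hf]
    have h1 := abs_term_le_of_decay510 h μ ν x.1
    have h2 := majorant_tail_le hδ.le (hS x.1 hx)
    calc |P μ ν x.1 * (x.1 μ : ℝ) * (x.1 ν : ℝ)| ≤ C * (l1 x.1 ^ 2 * Real.exp (-δ₁ * l1 x.1)) := h1
      _ ≤ C * (Real.exp (-(δ₁ / 2) * R) * (l1 x.1 ^ 2 * Real.exp (-(δ₁ / 2) * l1 x.1))) := mul_le_mul_of_nonneg_left h2 hC
      _ = Real.exp (-(δ₁ / 2) * R) * g x := by rw [hg]; ring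
  have hgS : Summable (fun x : ↥((S : Set (Fin d → ℤ))ᶜ) => Real.exp (-(δ₁ / 2) * R) * g x) :=
    (hgsumm.subtype _).mul_left _
  have hbound := tsum_of_norm_bounded hgS.hasSum hpt
  rw [Real.norm_eq_abs] at hbound
  rw [htail]
  refine hbound.trans ?_
  rw [tsum_mul_left]
  refine mul_le_mul_of_nonneg_left ?_ (Real.exp_pos _).le
  -- the complement's majorant sum is at most the full one = betaPrime510 d C (δ₁/2)
  have hle : ∑' x : ↥((S : Set (Fin d → ℤ))ᶜ), g x ≤ ∑' x, g x := Summable.tsum_subtype_le g _ hg0 hgsumm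
  refine hle.trans (le_of_eq ?_)
  rw [hg, betaPrime510, tsum_mul_left]

/-! ## §3 The engine's reading -/

/-- [folklore] **THE ENGINE's ENCLOSURE**: with `τ := e^{−(δ₁∕2)R}·betaPrime510 d C (δ₁∕2)`, the (1.22) moment lies in `[Σ_S − τ, Σ_S + τ]` — a certified
finite sum over the `|x|₁ < R` ball plus NUMERIC `(C, δ₁)` encloses `secondMoment P μ ν`; for the step kernels of row (D1) this is the input the refutation
socket `Gaps.D1ValueSockets.not_d1Drift_of_gap` consumes (every entry of `TOf J` is `Decay510`, `OneStepKernelFamily.hdec_TOf` — existentially). -/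
theorem secondMoment_mem_Icc_of_decay510_sum {P : B12Beta.Kernel d} {C δ₁ : ℝ} {μ ν : Fin d} (hδ : 0 < δ₁)
    (h : Decay510 (P μ ν) C δ₁) (S : Finset (Fin d → ℤ)) {R : ℝ} (hS : ∀ x, x ∉ S → R ≤ l1 x) :
    B12Beta.secondMoment P μ ν ∈
      Set.Icc (∑ x ∈ S, P μ ν x * (x μ : ℝ) * (x ν : ℝ) - Real.exp (-(δ₁ / 2) * R) * betaPrime510 d C (δ₁ / 2))
        (∑ x ∈ S, P μ ν x * (x μ : ℝ) * (x ν : ℝ) + Real.exp (-(δ₁ / 2) * R) * betaPrime510 d C (δ₁ / 2)) := by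
  have hb := abs_le.mp (abs_secondMoment_sub_sum_le_of_decay510 hδ h S hS)
  exact ⟨by linarith [hb.1], by linarith [hb.2]⟩

end Summit.QuantumFields.BalabanUV.Gaps.SecondMomentTruncation

end
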